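import Summits.AtomisticToContinuum.HydrodynamicLimit.Theses.TwoClocks
import Summits.AtomisticToContinuum.HydrodynamicLimit.Theorems.TwoClocksEntropyToHydro

/-!
# Route TwoClocks — the rev-10 `Assembly` frame (item stmt-AtomisticToContinuum-16626): reductions

`Assembly` (rev 10) is the frame statement
`KineticWindowLDUniform → ClampedTransferWindowLD → EnergyCurrentTails → TransferActivityTails →
UniformLocalGibbsConcentration → HsEosLowDensity → DiluteSelfConsistency → HydrodynamicLimit`.
Two of its seven antecedents are THEOREMS of the tree (`UniformLocalGibbsConcentration`, closed item
stmt-AtomisticToContinuum-14445, `Theorems.twoClocks_uniformLocalGibbsConcentration_proof` in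
`OneFlightGossipEngineUniformLocalGibbsConcentration.lean`; `HsEosLowDensity`, `HsEosLowDensity_holds`
in the route file), so the frame is LOGICALLY EQUIVALENT to crux 11 `TransferEntropyClock`
(stmt-AtomisticToContinuum-16625: the same implication without the two statics, tail inputs swapped):
`twoClocksAssembly_of_transferEntropyClock` and `transferEntropyClock_of_twoClocksAssembly` (the latter
keeps `UniformLocalGibbsConcentration` as an explicit, already-proved hypothesis so that this file does
not import the `OneFlightGossipEngine` route module; the companion file
`TwoClocksAssemblyReductionsStatics.lean` discharges it). Consequently the item carries no obligation of
its own: it closes by `twoClocksAssembly_of_transferEntropyClock` the moment crux 11 closes, and conversely a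
direct proof of the frame closes crux 11 by `transferEntropyClock_of_twoClocksAssembly`.

Also recorded, sorry-free: the Statement closes the frame with idle antecedents
(`twoClocksAssembly_of_hydrodynamicLimit`; with the PROVED glue `entropyToHydro_proof` this covers the
entropy target `RelEntropyVanishing`, see the `example` — since the statement re-type D-0032
(2026-08-16T21:23Z: `_root_.HydrodynamicLimit` is the PACKING-GUARDED conjunct, no longer an `abbrev` of
the Literature constant) the Literature-valued glue is bridged by `HydrodynamicLimit.of_unguarded`), and
the vacuity record
`twoClocksAssembly_of_not_input` (any refutation of one of the five OPEN antecedents closes the frame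
ex falso — as happened to the rev-4 frame stmt-13805 through the Lean refutation of
ex-crux stmt-13733).

What is deliberately NOT here: no proof of the frame from its antecedents. As typed, the kinetic node
`KineticWindowLDUniform` and the collisional node `ClampedTransferWindowLD` deliver their thresholds
`β₀, τ` POINTWISE (per reference profile, per test functional); Yau's relative-entropy Gronwall along
the time-dependent local Gibbs reference needs them uniformly along the compact reference family
(the 14680 / 9133 / 15145 leads' UNIFORMITY finding, `Cruxes/ClampedEntropyClock/NOTES.md`), so the
honest content is crux 11 and its foreseen family-uniform children, not this file.
-/

namespace Summit.AtomisticToContinuum.HydrodynamicLimit.Theorems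

open Summit.AtomisticToContinuum.HydrodynamicLimit.Theses.TwoClocks

/-- **Crux 11 closes the frame.** `TransferEntropyClock → Assembly`: feed the kinetic node, the
clamped collisional node, the two tail inputs (note the swapped order) and dilute self-consistency to
the clock and discard the two statics. This is the planner's checked term
`fun hK h₃ h₆ h₇ _ _ hS => hC hK h₃ h₇ h₆ hS`. [folklore] -/
theorem twoClocksAssembly_of_transferEntropyClock (hC : TransferEntropyClock) : Assembly := by
  unfold Assembly
  intro hK h₃ h₆ h₇ _ _ hS
  exact hC hK h₃ h₇ h₆ hS

/-- **The frame closes crux 11, given the statics.** `UniformLocalGibbsConcentration → Assembly →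
TransferEntropyClock`: of the two extra antecedents of the frame, `HsEosLowDensity`
(stmt-AtomisticToContinuum-0768) is supplied by the route file's `HsEosLowDensity_holds`, and
`UniformLocalGibbsConcentration` (stmt-AtomisticToContinuum-14445, equally PROVED:
`Theorems.twoClocks_uniformLocalGibbsConcentration_proof`) is kept as an explicit hypothesis here only
to avoid importing the `OneFlightGossipEngine` route module (discharged in the companion file
`TwoClocksAssemblyReductionsStatics.lean`). Together with `twoClocksAssembly_of_transferEntropyClock`:
the frame (stmt-AtomisticToContinuum-16626) and crux 11 (stmt-AtomisticToContinuum-16625) are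
logically equivalent — the assembly item has no content beyond the macroscopic clock. [folklore] -/
theorem transferEntropyClock_of_twoClocksAssembly (hU : UniformLocalGibbsConcentration)
    (hA : Assembly) : TransferEntropyClock := by
  unfold TransferEntropyClock
  intro hK h₃ h₇ h₆ hS
  exact hA hK h₃ h₆ h₇ hU HsEosLowDensity_holds hS

/-- **The Statement closes the frame** with all seven antecedents idle (the frame is weaker than the
sub-problem Statement, hence refutable only through `¬ HydrodynamicLimit` or vacuity). In particular
the shared entropy target `RelEntropyVanishing` (stmt-AtomisticToContinuum-0766) closes it through the
landed entropy-inequality glue: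
`twoClocksAssembly_of_hydrodynamicLimit (HydrodynamicLimit.of_unguarded (entropyToHydro_proof hRE))`
(`entropyToHydro_proof : EntropyToHydro` concludes the UNGUARDED Literature constant,
`Theorems/TwoClocksEntropyToHydro.lean`; `HydrodynamicLimit.of_unguarded` is the Statement file's bridge to
the packing-guarded conjunct of the re-type D-0032; this is the term of the pre-rev-10
`assembly_of_relEntropyVanishing`, whose module no longer elaborates after the restatement and is
therefore not imported). [folklore] -/
theorem twoClocksAssembly_of_hydrodynamicLimit (h : _root_.HydrodynamicLimit) : Assembly := by
  unfold Assembly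
  intro _ _ _ _ _ _ _
  exact h

/-- The entropy-target instance, stated so that the glue is exercised in this file: a proof of
`RelEntropyVanishing` yields the unguarded Literature conjecture (`entropyToHydro_proof`), hence the
packing-guarded sub-problem Statement (`HydrodynamicLimit.of_unguarded`, statement re-type D-0032),
and hence the frame (`twoClocksAssembly_of_hydrodynamicLimit`). [cite: Yau1991, §2] -/
example (hRE : RelEntropyVanishing) : Assembly :=
  twoClocksAssembly_of_hydrodynamicLimit (_root_.HydrodynamicLimit.of_unguarded (entropyToHydro_proof hRE))

/-- **Vacuity record.** The five OPEN antecedents of the frame are the kinetic node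
`KineticWindowLDUniform` (stmt-14442), the clamped collisional node `ClampedTransferWindowLD`
(stmt-16623), the tail inputs `EnergyCurrentTails` (stmt-9235) and `TransferActivityTails`
(stmt-16624), and `DiluteSelfConsistency` (stmt-3091); a Lean refutation of any one of them closes
the frame ex falso (as the Lean refutation of ex-crux stmt-13733 closed the rev-4 frame stmt-13805).
[folklore] -/
theorem twoClocksAssembly_of_not_input
    (h : ¬ KineticWindowLDUniform ∨ ¬ ClampedTransferWindowLD ∨ ¬ EnergyCurrentTails ∨
      ¬ TransferActivityTails ∨ ¬ DiluteSelfConsistency) : Assembly := by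
  unfold Assembly
  intro hK h₃ h₆ h₇ _ _ hS
  rcases h with h | h | h | h | h
  · exact absurd hK h
  · exact absurd h₃ h
  · exact absurd h₆ h
  · exact absurd h₇ h
  · exact absurd hS h

end Summit.AtomisticToContinuum.HydrodynamicLimit.Theorems
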